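import Summits.BirchSwinnertonDyer.BirchSwinnertonDyer.Theorems.BiquadraticEisensteinDescentEisensteinDivisibilityCMInertBadFlatAtOneStubEa
import Summits.BirchSwinnertonDyer.BirchSwinnertonDyer.Theorems.BiquadraticEisensteinDescentEisensteinDivisibilityCMInertBadFlatAtOneStubE2
import Summits.BirchSwinnertonDyer.BirchSwinnertonDyer.Theorems.BiquadraticEisensteinDescentEisensteinDivisibilityCMInertBadFlatAtOneStubE0
import Summits.BirchSwinnertonDyer.BirchSwinnertonDyer.Theorems.BiquadraticEisensteinDescentEisensteinDivisibilityCMInertBadStubE3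
import HarnessLib

set_option linter.dupNamespace false -- `Summit.BirchSwinnertonDyer.BirchSwinnertonDyer.Theorems.…` (summit = sub)
set_option autoImplicit false

/-!
# Route `BiquadraticEisensteinDescent` (W-ALL row 12 · K12i), crux (E♭°) stmt-BirchSwinnertonDyer-20452 —
# the GLUE of the tenure planner's rev-10 SPLIT of the threaded parent
# `EisensteinDivisibilityCMInertBadFlatAtOneOfPrint` into `EisensteinHeartCMInertBad` (the promoted research stub
# `stub_E1B`, with the `Λ`-torsion antecedent) and `AbsIrrModPBaseChangeCMInert` ((Irr), provable support), BY VALUE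

Cell `pub/bsd-wall`, prover seat `bsd-wall-bed-p2` (g3), 2026-08-27; package of record
`HOME/bsd-wall-cm/rev9/README.md §v4` (Heart.sig 5eacee2ea27f33a9, AbsIrr9.sig 14045b46b4dacdf9, E10.sig cb6187bfb9c6896d,
children-E.json). The route edit that creates those three decls is frozen until 2026-08-28T08:25:30Z; this file states

* `ofPrint_of_heart_of_absIrr : <Heart.sig verbatim> → <AbsIrr9.sig verbatim> → <E10.sig verbatim>`

WITHOUT naming any `Theses.…` decl, so that after the edit the split's glue item closes by
`exact …OfPrintOfParts.ofPrint_of_heart_of_absIrr` (and the planner may cite this proposal with `--glue-by`). The proof is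
the tree theorem `…FlatAtOneOfFacts.flatAtOne_of_stubE1B_of_facts` (p520683, bed-p1 g2) re-run BY VALUE with two changes the
rev-10 texts force: the heart is invoked WITH the torsion hypothesis of the parent (p520683 takes the torsion-free `∀`-stub,
so it cannot be cited), and (Irr) is no longer a binder of the parent but is supplied by the second child at `(W, p, K′)`.
Chain (unchanged): `R₀`-frame `L₁` from (A∞) Hsieh Thm. A any level + (R) BDP13 reciprocity + `Odd d_K′`
(`…StubE0.exists_isBDPLFunction_of_thmA_anyLevel_of_bdp2013`, p519641) → `p^m · Ch ⊆ (L₁)` (the heart) → `p ∤ L₁` from (B)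
Hsieh Thm. B any level + (Irr) (`…StubE2.not_C_dvd_of_isBDPLFunction_of_thmB_anyLevel`, p519061) → `Ch·R₀⟦T⟧ ⊆ (L₁)`
(`…StubE3.stub_E3`, p508737) → `(L₁)·𝓞_{ℂ_p}⟦T⟧ = (Q)` (`…StubEa.span_map_eq_span_of_isBDPLFunction_of_isBDPLFunctionInt`,
p518297) → constant terms.

HONEST FRAMING: THEOREMS ONLY (0 definitions, 0 named facts, 0 `sorry`); an IMPLICATION between spelled-out propositions —
nothing is asserted about the heart (NOT IN PRINT: Hsieh JAMS 2014 Thm. 2 hypothesis (2) fails for `ψ_L`, bed-p1 g2 verdict)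
nor about (Irr); the three print inputs (A∞)/(B)/(R) are antecedents of the conclusion exactly as in E10.sig. Supports, does
not close, stmt-BirchSwinnertonDyer-20452.
References: [Hsieh2014] Thm. A, Thm. B (Doc. Math. 19 p. 712); [Hsieh2014JAMS] Thm. 2 p. 3; [BertoliniDarmonPrasanna2013]
Thm. 5.5; [Castella2018] Thm. 3.1 (arXiv:1704.06608 p. 9).
-/

noncomputable section

open scoped Classical NumberField

open PowerSeries NumberField IsDedekindDomain Field WeierstrassCurve
  Literature.NumberTheory.EllipticCurves Literature.NumberTheory.EllipticCurves.ModularForms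
  Literature.NumberTheory.EllipticCurves.Rank1Residual
  Literature.NumberTheory.GaloisRepresentations Literature.NumberTheory.Automorphic
  Literature.NumberTheory.EllipticCurves.Hsieh2014
  Summit.BirchSwinnertonDyer.Rank1Residual.X11b
  Summit.BirchSwinnertonDyer.Rank1Residual.X11b.AcSelmer Summit.BirchSwinnertonDyer.Rank1Residual.X11b.Halves
  Summit.BirchSwinnertonDyer.BirchSwinnertonDyer.Theorems.BiquadraticEisensteinDescentEisensteinDivisibilityCMInertBadFlatAtOneStubEa
  Summit.BirchSwinnertonDyer.BirchSwinnertonDyer.Theorems.BiquadraticEisensteinDescentEisensteinDivisibilityCMInertBadFlatAtOneStubE2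
  Summit.BirchSwinnertonDyer.BirchSwinnertonDyer.Theorems.BiquadraticEisensteinDescentEisensteinDivisibilityCMInertBadFlatAtOneStubE0
  Summit.BirchSwinnertonDyer.BirchSwinnertonDyer.Theorems.BiquadraticEisensteinDescentEisensteinDivisibilityCMInertBadStubE3

namespace Summit.BirchSwinnertonDyer.BirchSwinnertonDyer.Theorems.BiquadraticEisensteinDescentEisensteinDivisibilityCMInertBadFlatAtOneOfPrintOfParts

/-- **Glue of the rev-10 split of (E♭°): heart + (Irr) ⟹ the threaded parent.** If (heart, = promoted `stub_E1B` with the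
`Λ`-torsion antecedent) for every `R₀`-frame `L` at a datum of the corner and every other prime `𝔭′ ∋ p` with
`X_ac(W/K′)` strict at `𝔭′` `Λ`-torsion, `p^m · Ch_Λ(X_ac) ⊆ (L)` for some `m`, and if (Irr) every framed mod-`p` Galois
representation attached to `W/K′` is absolutely irreducible for every imaginary quadratic Heegner field `K′` of the corner,
then — granted (A∞) Hsieh Thm. A at any level, (B) Hsieh Thm. B at any level and (R) BDP13 central-value reciprocity, in
this order — at every datum of the corner with `Odd d_K′` and torsion `X_ac`, the constant terms of `Ch_Λ(X_ac(W/K′), 𝔭′-strict)`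
lie in `Q(𝟙)·𝓞_{ℂ_p}` for every ♭-frame `Q`. Proof = p520683's chain with the torsion hypothesis handed to the heart and
(Irr) taken from the second hypothesis. CONDITIONAL on its two hypotheses (the first is OPEN research) and on the three
named facts in the conclusion's antecedent. [cite: Hsieh2014, Thm. A and Thm. B p. 712 (Doc. Math. 19)]
[cite: BertoliniDarmonPrasanna2013, Thm. 5.5 (p. 60)] [cite: Castella2018, Thm. 3.1 (arXiv:1704.06608 p. 9)] -/
theorem ofPrint_of_heart_of_absIrr
    (hHeart : ∀ (W : WeierstrassCurve ℚ) [W.IsElliptic] [W.IsGloballyMinimal] (p : ℕ) [Fact p.Prime]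
      [NeZero (W.conductorNorm ℤ)] (K : Type) [Field K] [NumberField K],
      W.HasCM → W.analyticRank = 1 → 5 ≤ p → CMInert W p → ¬ Good W p →
      IsImaginaryQuadratic K → SatisfiesHeegnerHypothesis (W.conductorNorm ℤ) K →
      4 < (NumberField.discr K).natAbs →
      (∀ (L : Type) [Field L] [NumberField L], Module.finrank ℚ L = 4 →
        (∃ x : L, x ^ 2 = ((cmFieldDiscrOfJ W.j : ℤ) : L)) → (∃ y : L, y ^ 2 = ((NumberField.discr K : ℤ) : L)) →
        ¬ p ∣ NumberField.classNumber L) →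
      (W.quadraticTwist (NumberField.discr K : ℚ)).entireLFunction 1 ≠ 0 →
      ∀ (κ : ZpExtension K p), κ.IsAnticyclotomic →
        ∀ (γ : Field.absoluteGaloisGroup K) [Fact (κ.IsTopGenerator γ)]
          (𝔭 : HeightOneSpectrum (𝓞 K)), ((p : ℕ) : 𝓞 K) ∈ 𝔭.asIdeal →
          𝔭.asIdeal.ramificationIdx (𝓞 ℚ) = 1 → 𝔭.asIdeal.inertiaDeg (𝓞 ℚ) = 1 →
          ∀ (f : CuspForm (CongruenceSubgroup.Gamma0 (W.conductorNorm ℤ)) 2), IsNewformOf W f →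
            ∀ (ι' : PadicAlgCl p ≃+* ℂ),
              (∀ (w : InfinitePlace K) (k : 𝓞 K), k ∈ 𝔭.asIdeal ↔ ‖ι'.symm (w.embedding (k : K))‖ < 1) →
              ∀ (ΩK : ℂ) (Ωp : (unrIntegers p)ˣ) (L : UnrSeries p), ΩK ≠ 0 →
                IsBDPLFunction ι' 𝔭 κ γ f ΩK ((Ωp : unrIntegers p) : ℂ_[p]) L →
                  ∀ (𝔭' : HeightOneSpectrum (𝓞 K)), ((p : ℕ) : 𝓞 K) ∈ 𝔭'.asIdeal → 𝔭' ≠ 𝔭 →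
                  Module.IsTorsion (IwasawaAlgebra p) (XAc (W.baseChange K) p κ 𝔭' ∅ γ) →
                  ∃ m : ℕ, ∀ x ∈ (XAc.charIdeal (W.baseChange K) p κ 𝔭' ∅ γ).map (PowerSeries.map (toUnr p)),
                    (PowerSeries.C ((p : ℕ) : unrIntegers p) : UnrSeries p) ^ m * x ∈ Ideal.span {L})
    (hIrr : ∀ (W : WeierstrassCurve ℚ) [W.IsElliptic] [W.IsGloballyMinimal] (p : ℕ) [Fact p.Prime]
      [NeZero (W.conductorNorm ℤ)], W.HasCM → 5 ≤ p → CMInert W p → ¬ Good W p →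
      ∀ (K : Type) [Field K] [NumberField K], IsImaginaryQuadratic K →
        SatisfiesHeegnerHypothesis (W.conductorNorm ℤ) K →
        ∀ ρ : ModPGaloisRep K (ZMod p) 2, (W.baseChange K).IsTorsionGaloisRep p ρ →
          FramedRep.IsAbsolutelyIrreducible ρ) :
  thmA_exists_isHsiehLFunction_unrPeriod_anyLevel →
  thmB_exists_isHsiehLFunction_coeff_norm_eq_one_unrPeriod_anyLevel →
  bertoliniDarmonPrasanna2013_centralValue_reciprocity →
  ∀ (W : WeierstrassCurve ℚ) [W.IsElliptic] [W.IsGloballyMinimal] (p : ℕ) [Fact p.Prime]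
    [NeZero (W.conductorNorm ℤ)] (K : Type) [Field K] [NumberField K],
    W.HasCM → W.analyticRank = 1 → 5 ≤ p → CMInert W p → ¬ Good W p →
    IsImaginaryQuadratic K → SatisfiesHeegnerHypothesis (W.conductorNorm ℤ) K →
    Odd (NumberField.discr K) →
    4 < (NumberField.discr K).natAbs →
    (∀ (L : Type) [Field L] [NumberField L], Module.finrank ℚ L = 4 →
      (∃ x : L, x ^ 2 = ((cmFieldDiscrOfJ W.j : ℤ) : L)) → (∃ y : L, y ^ 2 = ((NumberField.discr K : ℤ) : L)) →
      ¬ p ∣ NumberField.classNumber L) →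
    (W.quadraticTwist (NumberField.discr K : ℚ)).entireLFunction 1 ≠ 0 →
    ∀ (κ : ZpExtension K p), κ.IsAnticyclotomic →
      ∀ (γ : Field.absoluteGaloisGroup K) [Fact (κ.IsTopGenerator γ)]
        (𝔭 : HeightOneSpectrum (𝓞 K)), ((p : ℕ) : 𝓞 K) ∈ 𝔭.asIdeal →
        𝔭.asIdeal.ramificationIdx (𝓞 ℚ) = 1 → 𝔭.asIdeal.inertiaDeg (𝓞 ℚ) = 1 →
        ∀ (𝔭' : HeightOneSpectrum (𝓞 K)), ((p : ℕ) : 𝓞 K) ∈ 𝔭'.asIdeal → 𝔭' ≠ 𝔭 →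
        Module.IsTorsion (IwasawaAlgebra p) (XAc (W.baseChange K) p κ 𝔭' ∅ γ) →
        ∀ (f : CuspForm (CongruenceSubgroup.Gamma0 (W.conductorNorm ℤ)) 2), IsNewformOf W f →
          ∀ (ι' : PadicAlgCl p ≃+* ℂ),
            (∀ (w : InfinitePlace K) (k : 𝓞 K), k ∈ 𝔭.asIdeal ↔ ‖ι'.symm (w.embedding (k : K))‖ < 1) →
            ∀ (ΩK : ℂ) (Ωp : (unrIntegers p)ˣ) (Q : PowerSeries (PadicComplexInt p)), ΩK ≠ 0 →
              R1.IsBDPLFunctionInt p ι' 𝔭 κ γ f ΩK ((Ωp : unrIntegers p) : (PadicComplex p)) Q →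
                (XAc.charIdeal (W.baseChange K) p κ 𝔭' ∅ γ).map
                    ((R1.toCpInt p).comp (PowerSeries.constantCoeff : IwasawaAlgebra p →+* ℤ_[p])) ≤
                  Ideal.span {PowerSeries.constantCoeff Q} := by
  intro hA hB hR W _ _ p _ _ K _ _ hCM hr hp5 hin hbad hK hHN hodd hd4 hadm hLt κ hκ γ hγ 𝔭 h𝔭 he hf 𝔭' h𝔭' hne
    htors f hfW ι' hι' ΩK Ωp Q hΩK hQ
  have hp2 : p ≠ 2 := by omega
  have hpN : p ∣ W.conductorNorm ℤ := (W.dvd_conductorNorm_iff_not_hasGoodReductionAtPrime p).mpr hbad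
  -- (E0) an `R₀`-frame, from (A∞) + (R) + `Odd d_K′`
  obtain ⟨ΩK₁, Ωp₁, L₁, hΩK₁, hL₁⟩ := exists_isBDPLFunction_of_thmA_anyLevel_of_bdp2013 hA hR hp2 ι' W K 𝔭 κ γ
    hfW rfl hpN hK hodd hHN h𝔭 he hf hι' hκ hγ.out
  -- the HEART at this frame and this other prime, WITH the torsion hypothesis of the parent
  obtain ⟨m, hm⟩ := hHeart W p K hCM hr hp5 hin hbad hK hHN hd4 hadm hLt κ hκ γ 𝔭 h𝔭 he hf f hfW ι' hι' ΩK₁ Ωp₁ L₁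
    hΩK₁ hL₁ 𝔭' h𝔭' hne htors
  -- (E2) `p ∤ L₁`, from (B) + (Irr) — (Irr) supplied by the second child at `(W, p, K′)`; (E3) prime avoidance
  have hE2 := not_C_dvd_of_isBDPLFunction_of_thmB_anyLevel hB W hp2 hpN hfW hK hHN h𝔭 hι'
    (hIrr W p hCM hp5 hin hbad K hK hHN) hκ hγ.out hΩK₁ hL₁
  have hB' : (XAc.charIdeal (W.baseChange K) p κ 𝔭' ∅ γ).map (PowerSeries.map (toUnr p)) ≤ Ideal.span {L₁} :=
    stub_E3 p _ L₁ m hE2 hm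
  -- (Ea) the same ideal in `𝓞_{ℂ_p}⟦T⟧`
  have hspan : Ideal.span {PowerSeries.map (R1.unrToCpInt p) L₁} = Ideal.span {Q} :=
    span_map_eq_span_of_isBDPLFunction_of_isBDPLFunctionInt hp2 hK hκ hγ.out hΩK hΩK₁
      (coe_units_unrIntegers_ne_zero Ωp) (coe_units_unrIntegers_ne_zero Ωp₁) hQ hL₁
  -- transfer to `𝓞_{ℂ_p}⟦T⟧` and take constant terms
  have hflat : (XAc.charIdeal (W.baseChange K) p κ 𝔭' ∅ γ).map (PowerSeries.map (R1.toCpInt p)) ≤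
      Ideal.span {Q} := by
    rw [R1.map_toCpInt_eq_comp, ← Ideal.map_map, ← hspan]
    refine (Ideal.map_mono hB').trans ?_
    rw [Ideal.map_span, Set.image_singleton]
  have hcc : ∀ g : IwasawaAlgebra p, PowerSeries.constantCoeff (PowerSeries.map (R1.toCpInt p) g) =
      R1.toCpInt p (PowerSeries.constantCoeff g) := fun g ↦ by
    rw [← PowerSeries.coeff_zero_eq_constantCoeff_apply, PowerSeries.coeff_map,
      PowerSeries.coeff_zero_eq_constantCoeff_apply]
  have hcomp : (R1.toCpInt p).comp (PowerSeries.constantCoeff : IwasawaAlgebra p →+* ℤ_[p]) =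
      (PowerSeries.constantCoeff : PowerSeries 𝓞_ℂ_[p] →+* 𝓞_ℂ_[p]).comp (PowerSeries.map (R1.toCpInt p)) := by
    ext g
    simp [hcc]
  rw [hcomp, ← Ideal.map_map]
  refine (Ideal.map_mono hflat).trans ?_
  rw [Ideal.map_span, Set.image_singleton]

end Summit.BirchSwinnertonDyer.BirchSwinnertonDyer.Theorems.BiquadraticEisensteinDescentEisensteinDivisibilityCMInertBadFlatAtOneOfPrintOfParts

end
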